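import Mathlib
import Summits.Ventures.PercRepro2.Defs
import Summits.Ventures.PercRepro2.Graph
import Summits.Ventures.PercRepro2.Induced
import Summits.Ventures.PercRepro2.VdBKahn
import Summits.Ventures.PercRepro2.ReimerVdBK
import Summits.Ventures.PercRepro2.ReimerVdBKTwisted
import Summits.Ventures.PercRepro2.ReimerVdBKTied
import Summits.Ventures.PercRepro2.ReimerVdBKCoreDown
import Summits.Ventures.PercRepro2.ReimerVdBKDegTwoCalc
import Summits.Ventures.PercRepro2.ReimerVdBKOuter

/-!
# Pattern sub-cubes, sums over the sub-cubes of a fibre, flips, and the closure lemma for stars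
(blind cell PercRepro2, mine-c g49; `conjectures/MINE-C.md` §58 — part I of the proof that (OUTER-R) at
`N = ∅` is Harris for every revealed set `R ⊆ X ∪ Y`, `ReimerVdBKOuterOneWorld`)

For an edge set `F` and a PATTERN `d` (a colouring, read on `F`), the sub-cube `onF F d` is the set of
colourings agreeing with `d` on `F`; it is the image of the free cube `Config {e // e ∉ F}` under `patch F d`
(the analogue of `tie` of `ReimerVdBKTied`), which is injective and monotone, and whose complement is the
patch of the complemented pattern (`compl_patch`) — so the pullback of `bar S` is the `bar` of the pullback
along the complemented pattern (`preimage_bar_patch`).  Counts on a sub-cube are counts of pullbacks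
(`count_inter_onF_eq`), and summing the counts on the sub-cubes of the patterns of an `F`-determined set
counts every colouring `count (onF F d)` times (`mul_count_inter_eq_sum_onF`).  `flipOn G` / `setOn G b`
flip / force a colouring on `G`.  THE CLOSURE LEMMA `conn_iff_of_closed_stars`: if `η₀ ≤ η` agree off the
stars of a vertex set `W` and every `w ∈ W` lies outside the cluster of `s` in some `η_w ≥ η₀` agreeing with
`η` on the star of `w`, then `η` and `η₀` have the same cluster of `s`; its special case `conn_iff_of_avoid`
(INERTNESS: closing the stars of vertices outside the cluster does not change the cluster) is the reason
the stars of the revealed vertices avoided by a world are inert in that world.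
-/

namespace Summit.Ventures.PercRepro2
namespace ReimerVdBK
open Classical

variable {V : Type*} {E : Type*} [Fintype E] [DecidableEq E] [Fintype V] [DecidableEq V]

/-! ## Pattern sub-cubes -/

section Patch
variable (F : Finset E)

omit [Fintype E] [Fintype V] [DecidableEq V] in
/-- The colourings agreeing with the pattern `d` on `F`. -/
def onF (d : Config E) : Set (Config E) := {ω | ∀ e ∈ F, ω e = d e}

omit [Fintype E] [Fintype V] [DecidableEq V] in
/-- The pattern sub-cube as a product: the free edges, the edges of `F` fixed to `d`. -/
def patch (d : Config E) (ω' : Config {e : E // e ∉ F}) : Config E :=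
  fun e => if h : e ∈ F then d e else ω' ⟨e, h⟩

omit [Fintype E] [Fintype V] [DecidableEq V] in
/-- `patch` on an edge of `F`. -/
lemma patch_of_mem {e : E} (he : e ∈ F) (d : Config E) (ω' : Config {e : E // e ∉ F}) :
    patch F d ω' e = d e := by
  simp [patch, he]

omit [Fintype E] [Fintype V] [DecidableEq V] in
/-- `patch` on a free edge. -/
lemma patch_of_not_mem {e : E} (he : e ∉ F) (d : Config E) (ω' : Config {e : E // e ∉ F}) :
    patch F d ω' e = ω' ⟨e, he⟩ := by
  simp [patch, he]

omit [Fintype E] [Fintype V] [DecidableEq V] in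
/-- `patch` is monotone in the free configuration. -/
lemma patch_mono (d : Config E) : Monotone (patch F d) := by
  intro ω₁ ω₂ h e
  by_cases he : e ∈ F
  · rw [patch_of_mem F he, patch_of_mem F he]
  · rw [patch_of_not_mem F he, patch_of_not_mem F he]
    exact h _

omit [Fintype E] [Fintype V] [DecidableEq V] in
/-- `patch` is monotone in the pattern (on `F`). -/
lemma patch_le_patch {d d' : Config E} (h : ∀ e ∈ F, d e ≤ d' e)
    (ω' : Config {e : E // e ∉ F}) : patch F d ω' ≤ patch F d' ω' := by
  intro e
  by_cases he : e ∈ F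
  · rw [patch_of_mem F he, patch_of_mem F he]
    exact h e he
  · rw [patch_of_not_mem F he, patch_of_not_mem F he]

omit [Fintype E] [Fintype V] [DecidableEq V] in
/-- The complement of a patched configuration is the patch of the complemented pattern. -/
lemma compl_patch (d : Config E) (ω' : Config {e : E // e ∉ F}) :
    compl (patch F d ω') = patch F (compl d) (compl ω') := by
  funext e
  by_cases he : e ∈ F
  · simp [patch, he, compl]
  · simp [patch, he, compl]

omit [Fintype E] [Fintype V] [DecidableEq V] in
/-- A patched configuration lies in the sub-cube of its pattern. -/
lemma patch_mem_onF (d : Config E) (ω' : Config {e : E // e ∉ F}) : patch F d ω' ∈ onF F d :=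
  fun _ he => patch_of_mem F he d ω'

omit [Fintype E] [Fintype V] [DecidableEq V] in
/-- `patch` is injective. -/
lemma patch_injective (d : Config E) : Function.Injective (patch F d) := by
  intro ω₁ ω₂ h
  funext ⟨e, he⟩
  have := congrFun h e
  rwa [patch_of_not_mem F he, patch_of_not_mem F he] at this

omit [Fintype E] [Fintype V] [DecidableEq V] in
/-- Every colouring of the sub-cube of `d` is patched. -/
lemma exists_patch_eq {d ω : Config E} (hω : ω ∈ onF F d) : ∃ ω', patch F d ω' = ω := by
  refine ⟨fun e => ω e.1, ?_⟩
  funext e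
  by_cases he : e ∈ F
  · rw [patch_of_mem F he]
    exact (hω e he).symm
  · rw [patch_of_not_mem F he]

omit [Fintype V] [DecidableEq V] in
/-- The count of `S` on the sub-cube of `d` is the count of its pullback. -/
lemma count_inter_onF_eq (d : Config E) (S : Set (Config E)) :
    count (S ∩ onF F d) = count (patch F d ⁻¹' S) := by
  rw [count_eq_card_tied, count_eq_card_tied]
  symm
  refine Finset.card_bij (fun ω' _ => patch F d ω') ?_ ?_ ?_
  · intro ω' h
    simp only [Finset.mem_filter, Finset.mem_univ, true_and, Set.mem_preimage] at h
    simp only [Finset.mem_filter, Finset.mem_univ, true_and, Set.mem_inter_iff]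
    exact ⟨h, patch_mem_onF F d ω'⟩
  · intro a _ b _ h
    exact patch_injective F d h
  · intro ω h
    simp only [Finset.mem_filter, Finset.mem_univ, true_and, Set.mem_inter_iff] at h
    obtain ⟨ω', rfl⟩ := exists_patch_eq F h.2
    exact ⟨ω', by simpa using h.1, rfl⟩

omit [Fintype V] [DecidableEq V] in
/-- The count of a sub-cube does not depend on its pattern. -/
lemma count_onF_eq (d : Config E) :
    count (onF F d) = count (Set.univ : Set (Config {e : E // e ∉ F})) := by
  have h := count_inter_onF_eq F d Set.univ
  rwa [Set.univ_inter, Set.preimage_univ] at h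

omit [Fintype E] [Fintype V] [DecidableEq V] in
/-- The pullback of the `bar` of a set is the `bar` of the pullback along the complemented pattern. -/
lemma preimage_bar_patch (d : Config E) (S : Set (Config E)) :
    patch F d ⁻¹' bar S = bar (patch F (compl d) ⁻¹' S) := by
  ext ω'
  simp only [Set.mem_preimage, mem_bar]
  rw [compl_patch]

end Patch

/-! ## Sums over the sub-cubes of a fibre -/

section SubcubeSum
variable (F : Finset E)

omit [Fintype V] [DecidableEq V] in
/-- Summing the counts on the sub-cubes of the patterns of an `F`-determined set `Fib` counts every colouring
of `Fib` exactly `count (onF F d)` times. -/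
lemma mul_count_inter_eq_sum_onF (S Fib : Set (Config E))
    (hFib : ∀ ω ω' : Config E, (∀ e ∈ F, ω e = ω' e) → ω ∈ Fib → ω' ∈ Fib) :
    count (Set.univ : Set (Config {e : E // e ∉ F})) * count (S ∩ Fib) =
      ∑ d : Config E, if d ∈ Fib then count (S ∩ onF F d) else 0 := by
  have key : ∀ d : Config E, (if d ∈ Fib then count (S ∩ onF F d) else 0) =
      ∑ ω : Config E, if ω ∈ S ∩ Fib ∧ ω ∈ onF F d then 1 else 0 := by
    intro d
    by_cases hd : d ∈ Fib
    · rw [if_pos hd]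
      unfold count
      refine Finset.sum_congr rfl fun ω _ => ?_
      by_cases h : ω ∈ S ∩ onF F d
      · rw [if_pos h, if_pos ⟨⟨h.1, hFib d ω (fun e he => (h.2 e he).symm) hd⟩, h.2⟩]
      · rw [if_neg h, if_neg (fun h' => h ⟨h'.1.1, h'.2⟩)]
    · rw [if_neg hd]
      symm
      refine Finset.sum_eq_zero fun ω _ => if_neg fun h => hd (hFib ω d h.2 h.1.2)
  simp only [key]
  rw [Finset.sum_comm]
  unfold count
  rw [Finset.mul_sum]
  refine Finset.sum_congr rfl fun ω _ => ?_
  by_cases hω : ω ∈ S ∩ Fib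
  · rw [if_pos hω, mul_one]
    have h1 : ∀ d : Config E, (if ω ∈ S ∩ Fib ∧ ω ∈ onF F d then (1 : ℕ) else 0) =
        if d ∈ onF F ω then 1 else 0 := by
      intro d
      have : ω ∈ onF F d ↔ d ∈ onF F ω := by
        simp only [onF, Set.mem_setOf_eq]
        exact ⟨fun h e he => (h e he).symm, fun h e he => (h e he).symm⟩
      by_cases h : ω ∈ onF F d
      · rw [if_pos ⟨hω, h⟩, if_pos (this.1 h)]
      · rw [if_neg (fun h' => h h'.2), if_neg (fun h' => h (this.2 h'))]
    simp only [h1]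
    have h2 := count_onF_eq F ω
    unfold count at h2
    rw [← h2]
  · rw [if_neg hω, mul_zero]
    symm
    exact Finset.sum_eq_zero fun d _ => if_neg fun h => hω h.1

end SubcubeSum

/-! ## Flips and forced patterns -/

section FlipSet
variable (G : Finset E)

omit [Fintype E] [Fintype V] [DecidableEq V] in
/-- Flip the colouring on the edge set `G`. -/
def flipOn (d : Config E) : Config E := fun e => if e ∈ G then !d e else d e

omit [Fintype E] [Fintype V] [DecidableEq V] in
/-- Force the colouring to `b` on the edge set `G`. -/
def setOn (b : Bool) (d : Config E) : Config E := fun e => if e ∈ G then b else d e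

omit [Fintype E] [Fintype V] [DecidableEq V] in
/-- `flipOn` on an edge of `G`. -/
lemma flipOn_of_mem {e : E} (he : e ∈ G) (d : Config E) : flipOn G d e = !d e := by simp [flipOn, he]

omit [Fintype E] [Fintype V] [DecidableEq V] in
/-- `flipOn` off `G`. -/
lemma flipOn_of_not_mem {e : E} (he : e ∉ G) (d : Config E) : flipOn G d e = d e := by simp [flipOn, he]

omit [Fintype E] [Fintype V] [DecidableEq V] in
/-- `setOn` on an edge of `G`. -/
lemma setOn_of_mem {e : E} (he : e ∈ G) (b : Bool) (d : Config E) : setOn G b d e = b := by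
  simp [setOn, he]

omit [Fintype E] [Fintype V] [DecidableEq V] in
/-- `setOn` off `G`. -/
lemma setOn_of_not_mem {e : E} (he : e ∉ G) (b : Bool) (d : Config E) : setOn G b d e = d e := by
  simp [setOn, he]

omit [Fintype E] [Fintype V] [DecidableEq V] in
/-- `flipOn G` is an involution. -/
lemma flipOn_involutive : Function.Involutive (flipOn G) := by
  intro d
  funext e
  by_cases he : e ∈ G
  · rw [flipOn_of_mem G he, flipOn_of_mem G he, Bool.not_not]
  · rw [flipOn_of_not_mem G he, flipOn_of_not_mem G he]

omit [Fintype E] [Fintype V] [DecidableEq V] in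
/-- The complement of a flipped colouring is the flip of the complement. -/
lemma compl_flipOn (d : Config E) : compl (flipOn G d) = flipOn G (compl d) := by
  funext e
  by_cases he : e ∈ G
  · simp [compl, flipOn, he]
  · simp [compl, flipOn, he]

omit [Fintype E] [Fintype V] [DecidableEq V] in
/-- The complement of a forced colouring is the forcing of the complement. -/
lemma compl_setOn (b : Bool) (d : Config E) : compl (setOn G b d) = setOn G (!b) (compl d) := by
  funext e
  by_cases he : e ∈ G
  · simp [compl, setOn, he]
  · simp [compl, setOn, he]

omit [Fintype E] [Fintype V] [DecidableEq V] in
/-- Flipping the colouring on `G` and patching commutes with flipping the pattern, for `G ⊆ F`. -/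
lemma flipOn_patch {F : Finset E} (hG : G ⊆ F) (d : Config E) (ω' : Config {e : E // e ∉ F}) :
    flipOn G (patch F d ω') = patch F (flipOn G d) ω' := by
  funext e
  by_cases hF : e ∈ F
  · rw [patch_of_mem F hF]
    by_cases he : e ∈ G
    · rw [flipOn_of_mem G he, flipOn_of_mem G he, patch_of_mem F hF]
    · rw [flipOn_of_not_mem G he, flipOn_of_not_mem G he, patch_of_mem F hF]
  · have he : e ∉ G := fun h => hF (hG h)
    rw [flipOn_of_not_mem G he, patch_of_not_mem F hF, patch_of_not_mem F hF]

end FlipSet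

/-! ## The closure lemma for stars -/

section Closure
variable (ends : E → Sym2 V) (s : V)

omit [Fintype E] [DecidableEq E] [Fintype V] [DecidableEq V] in
/-- **Closure lemma for stars.**  Let `η₀ ≤ η` agree on every edge not incident to the vertex set `W`, and
suppose that every `w ∈ W` is outside the cluster of `s` in some configuration `η_w ≥ η₀` that agrees with
`η` on the star of `w`.  Then the cluster of `s` in `η` is its cluster in `η₀`. -/
lemma conn_iff_of_closed_stars {η η₀ : Config E} (W : Finset V) (hle : η₀ ≤ η)
    (hoff : ∀ e, (∀ w ∈ W, w ∉ ends e) → η₀ e = η e)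
    (hW : ∀ w ∈ W, ∃ ηw : Config E, η₀ ≤ ηw ∧ (∀ e, w ∈ ends e → ηw e = η e) ∧ ¬ Conn ends ηw s w)
    (u : V) : Conn ends η s u ↔ Conn ends η₀ s u := by
  refine ⟨fun h => ?_, conn_mono hle⟩
  refine mem_of_conn_of_closed (ends := ends) (ω := η) (S := {x | Conn ends η₀ s x}) ?_
    (conn_refl ends η₀ s) h
  intro x hx y hxy
  obtain ⟨_, e, he, hends⟩ := openGraph_adj.1 hxy
  simp only [Set.mem_setOf_eq] at hx ⊢
  by_cases hW' : ∃ w ∈ W, w ∈ ends e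
  · obtain ⟨w, hwW, hwe⟩ := hW'
    obtain ⟨ηw, hle', hagree, hnc⟩ := hW w hwW
    have hwe' : w = x ∨ w = y := by
      rw [hends] at hwe
      exact Sym2.mem_iff.1 hwe
    have hxw : Conn ends ηw s x := conn_mono hle' hx
    have hew : ηw e = true := by rw [hagree e hwe]; exact he
    exfalso
    rcases hwe' with rfl | rfl
    · exact hnc hxw
    · exact hnc (conn_trans hxw (conn_of_openAdj ⟨e, hew, hends⟩))
  · have h0 : η₀ e = true := by
      rw [hoff e (fun w hw hwe => hW' ⟨w, hw, hwe⟩)]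
      exact he
    exact conn_trans hx (conn_of_openAdj ⟨e, h0, hends⟩)

omit [Fintype E] [DecidableEq E] [Fintype V] [DecidableEq V] in
/-- **Inertness.**  Closing edges at vertices outside the cluster of `s` does not change the cluster. -/
lemma conn_iff_of_avoid {η η₀ : Config E} (W : Finset V) (hle : η₀ ≤ η)
    (hoff : ∀ e, (∀ w ∈ W, w ∉ ends e) → η₀ e = η e)
    (hav : ∀ w ∈ W, ¬ Conn ends η s w) (u : V) : Conn ends η s u ↔ Conn ends η₀ s u :=
  conn_iff_of_closed_stars ends s W hle hoff (fun w hw => ⟨η, hle, fun _ _ => rfl, hav w hw⟩) u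

end Closure

end ReimerVdBK
end Summit.Ventures.PercRepro2
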